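import Mathlib
import HarnessLib
import Literature.Probability.MarkovChains.IndependenceSamplerSpectralGap
import Literature.Probability.MarkovChains.MixtureProposalPeskun
import Literature.Probability.MarkovChains.DelayedRejection
import Literature.Probability.MarkovChains.DelayedAcceptance

/-!
# Three exact ways to combine the flow proposal with other moves, and how they order against the
# plain flow-IMH step: mixture proposals, delayed rejection, delayed acceptance

HONEST FRAMING: exact (Metropolis-corrected) sampling algorithms for lattice gauge theory;
figures of merit are autocorrelation/cost numbers at stated couplings and volumes; no
continuum-physics claim.

Venture `LatticeQCDFlow` (cell pub-lqcd), topic `Scoring`; row 33 (`lit-codes`, literature-prover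
seat GEN-42).  NEW WORK of the cell = the flow-sampler SPECIALISATIONS of three Literature theorems
landed this generation, with the irreducibility hypotheses DISCHARGED (the Metropolized independence
sampler on a model `q > 0` has all entries positive, `IndependenceSamplerSpectralGap.imh_pos`), so
that each statement below is unconditional in the cell's setting: finite state space, target
`p > 0` with `Σ p = 1`, flow model `q > 0` with `Σ q = 1`, flow-IMH matrix
`A = mhKernel (fun _ z => q z) p`.  Nothing is cited as a fact and no definition is introduced.

* **MIXTURE PROPOSAL ≽ MIXTURE OF KERNELS** (Tierney 1998 Prop. 5 / Liu 2001 Thm 13.3.4,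
  `MixtureProposalPeskun.lean`): `flowLocalMixture_offDiag`, `asympVar_flowLocalMixtureProposal_le` —
  with weight `a` on the flow proposal and `1 − a` on any local proposal matrix `T ≥ 0`
  (sub-stochastic), ONE Metropolis–Hastings step with the mixture proposal `a·q + (1−a)·T(x,·)` has
  asymptotic variance no larger than the random alternation "with probability `a` a flow-IMH step,
  else a local Metropolis–Hastings step", for every observable (the alternation being irreducible as
  soon as `a > 0`); `spectralGapR_flowLocalMixture_le` — and no smaller right spectral gap.  (Cost
  caveat, Tierney's: the mixture-proposal step must evaluate BOTH densities at every step.)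
* **DELAYED REJECTION ≽ FLOW-IMH** (Tierney–Mira 1999, `DelayedRejection.lean`):
  `asympVar_flowDR_le_imh` — proposing from the flow first and, upon rejection, trying ANY second-stage
  proposal `q₂(x,s,·) ≥ 0` (sub-stochastic; e.g. a local move) with the Tierney–Mira acceptance keeps
  `p` invariant (`drKernel_detailedBalance`) and never increases the asymptotic variance of the
  flow-IMH chain, for every observable; `spectralGapR_imh_le_flowDR`.
* **DELAYED ACCEPTANCE ≼ FLOW-IMH** (Liu 2001 §9.4.3 / Christen–Fox 2005 / Banterle et al. 2019,
  `DelayedAcceptance.lean`): `asympVar_imh_le_flowDA` — screening the flow proposal with a cheap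
  approximate target `p* > 0` (accept with the `p*/q` ratio) and only then paying for `p/p*` is exact
  (`surrogateKernel_detailedBalance`) but has asymptotic variance AT LEAST that of the direct flow-IMH
  step for every observable (it buys cheaper steps, not better ones); `spectralGapR_flowDA_le_imh`.

NOT CLAIMED: strictness; any cost model (which of the three pays is an empirical question the cell's
LEADERBOARD answers, not this file); general state spaces; anything about a specific flow or any
number of ours.
-/

namespace Summit.Ventures.LatticeQCDFlow.Scoring

open Finset Literature.Probability.MarkovChains

variable {X : Type*} [Fintype X] [DecidableEq X] {p q : X → ℝ}

/-! ## Mixture proposal versus alternation of kernels -/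

omit [Fintype X] [DecidableEq X] in
/-- Weights `(a, 1 − a)` on (flow = `true`, local = `false`) are non-negative for `0 ≤ a ≤ 1`. -/
private theorem flowLocalWeight_nonneg {a : ℝ} (ha0 : 0 ≤ a) (ha1 : a ≤ 1) :
    ∀ b, 0 ≤ (fun b : Bool => if b then a else 1 - a) b := by
  intro b; cases b <;> simp [ha0, ha1]

omit [Fintype X] [DecidableEq X] in
/-- … and sum to one. -/
private theorem flowLocalWeight_sum (a : ℝ) : ∑ b, (fun b : Bool => if b then a else 1 - a) b = 1 := by
  simp

omit [Fintype X] [DecidableEq X] in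
/-- Both components (flow proposal `q`, local proposal `T`) are non-negative. -/
private theorem flowLocal_nonneg (hq : ∀ x, 0 < q x) {T : X → X → ℝ} (hT : ∀ x y, 0 ≤ T x y) :
    ∀ b x y, 0 ≤ (fun (b : Bool) (x y : X) => if b then q y else T x y) b x y := by
  intro b x y; cases b
  · simpa using hT x y
  · simpa using (hq y).le

omit [DecidableEq X] in
/-- … and sub-stochastic. -/
private theorem flowLocal_row_le (hq1 : ∑ x, q x = 1) {T : X → X → ℝ}
    (hTrow : ∀ x, ∑ y, T x y ≤ 1) :
    ∀ b x, ∑ y, (fun (b : Bool) (x y : X) => if b then q y else T x y) b x y ≤ 1 := by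
  intro b x; cases b
  · simpa using hTrow x
  · simp [hq1]

/-- The mixture of kernels `a·A_flow + (1−a)·A_local` written out (component `true` = a flow-IMH
step, component `false` = a local Metropolis–Hastings step with proposal matrix `T`). -/
theorem mhMixture_flowLocal (a : ℝ) (T : X → X → ℝ) (x y : X) :
    mhMixture (fun b : Bool => if b then a else 1 - a) (fun (b : Bool) (x y : X) => if b then q y else T x y) p x y =
      a * mhKernel (fun _ z => q z) p x y + (1 - a) * mhKernel T p x y := by
  unfold mhMixture
  rw [Fintype.sum_bool]
  rfl

omit [Fintype X] [DecidableEq X] in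
/-- The mixture proposal `a·q(y) + (1−a)·T(x,y)` written out. -/
theorem mixtureProposal_flowLocal (a : ℝ) (T : X → X → ℝ) (x y : X) :
    mixtureProposal (fun b : Bool => if b then a else 1 - a)
      (fun (b : Bool) (x y : X) => if b then q y else T x y) x y = a * q y + (1 - a) * T x y := by
  unfold mixtureProposal
  rw [Fintype.sum_bool]
  rfl

/-- **Entrywise**: off the diagonal, `a·A_flow(x,y) + (1−a)·A_local(x,y) ≤ A_mix(x,y)`, `A_mix` the
Metropolis–Hastings step with proposal `a·q + (1−a)·T(x,·)` (`0 ≤ a ≤ 1`). -/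
theorem flowLocalMixture_offDiag {a : ℝ} (ha0 : 0 ≤ a) (ha1 : a ≤ 1) (T : X → X → ℝ) {x y : X}
    (hxy : x ≠ y) :
    a * mhKernel (fun _ z => q z) p x y + (1 - a) * mhKernel T p x y ≤
      mhKernel (mixtureProposal (fun b : Bool => if b then a else 1 - a)
      (fun (b : Bool) (x y : X) => if b then q y else T x y)) p x y := by
  rw [← mhMixture_flowLocal]
  exact Liu2001_thm_13_3_4 (flowLocalWeight_nonneg ha0 ha1) p hxy

/-- The alternation of flow-IMH and local steps is irreducible as soon as the flow component has
positive weight (the flow-IMH matrix has all entries positive). -/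
theorem mhMixture_flowLocal_isIrreducible (hp : ∀ x, 0 < p x) (hq : ∀ x, 0 < q x)
    (hq1 : ∑ x, q x = 1) {a : ℝ} (ha : 0 < a) (ha1 : a ≤ 1) {T : X → X → ℝ}
    (hT : ∀ x y, 0 ≤ T x y) (hTrow : ∀ x, ∑ y, T x y ≤ 1) :
    IsIrreducible (mhMixture (fun b : Bool => if b then a else 1 - a) (fun (b : Bool) (x y : X) => if b then q y else T x y) p) := by
  intro x y
  refine ⟨1, ?_⟩
  rw [pow_one, mhMixture_flowLocal]
  exact add_pos_of_pos_of_nonneg (mul_pos ha (imh_pos hp hq hq1 x y))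
    (mul_nonneg (by linarith) (mhKernel_nonneg hT hTrow hp x y))

/-- **MIXTURE PROPOSAL ≽ ALTERNATION, asymptotic variance**: for `0 < a ≤ 1` and every observable
`f`, `v(f, A_mix) ≤ v(f, a·A_flow + (1−a)·A_local)`. -/
theorem asympVar_flowLocalMixtureProposal_le (hp : ∀ x, 0 < p x) (hp1 : ∑ x, p x = 1)
    (hq : ∀ x, 0 < q x) (hq1 : ∑ x, q x = 1) {a : ℝ} (ha : 0 < a) (ha1 : a ≤ 1)
    {T : X → X → ℝ} (hT : ∀ x y, 0 ≤ T x y) (hTrow : ∀ x, ∑ y, T x y ≤ 1) (f : X → ℝ) :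
    asympVar f p (mhKernel (mixtureProposal (fun b : Bool => if b then a else 1 - a)
      (fun (b : Bool) (x y : X) => if b then q y else T x y)) p) ≤
      asympVar f p (mhMixture (fun b : Bool => if b then a else 1 - a) (fun (b : Bool) (x y : X) => if b then q y else T x y) p) :=
  Liu2001_thm_13_3_4_asympVar hp hp1 (flowLocalWeight_nonneg ha.le ha1) (flowLocalWeight_sum a)
    (flowLocal_nonneg hq hT) (flowLocal_row_le hq1 hTrow)
    (mhMixture_flowLocal_isIrreducible hp hq hq1 ha ha1 hT hTrow) f

/-- **… and right spectral gap**: `Gap_R(a·A_flow + (1−a)·A_local) ≤ Gap_R(A_mix)` (`0 ≤ a ≤ 1`). -/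
theorem spectralGapR_flowLocalMixture_le (hp : ∀ x, 0 < p x) (hq : ∀ x, 0 < q x)
    (hq1 : ∑ x, q x = 1) {a : ℝ} (ha0 : 0 ≤ a) (ha1 : a ≤ 1) {T : X → X → ℝ}
    (hT : ∀ x y, 0 ≤ T x y) (hTrow : ∀ x, ∑ y, T x y ≤ 1) :
    spectralGapR p (mhMixture (fun b : Bool => if b then a else 1 - a) (fun (b : Bool) (x y : X) => if b then q y else T x y) p) ≤
      spectralGapR p (mhKernel (mixtureProposal (fun b : Bool => if b then a else 1 - a)
      (fun (b : Bool) (x y : X) => if b then q y else T x y)) p) :=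
  Liu2001_thm_13_3_4_spectralGapR hp (flowLocalWeight_nonneg ha0 ha1) (flowLocalWeight_sum a)
    (flowLocal_nonneg hq hT) (flowLocal_row_le hq1 hTrow)

/-! ## Delayed rejection: flow first, anything second -/

/-- **DELAYED REJECTION NEVER HURTS THE FLOW-IMH CHAIN**: with the flow proposal as first stage and
ANY non-negative sub-stochastic second-stage proposal `q₂(x,s,·)` accepted by the Tierney–Mira rule,
`v(f, k_DR) ≤ v(f, A_flow)` for every observable `f` (no irreducibility hypothesis: `A_flow > 0`). -/
theorem asympVar_flowDR_le_imh (hp : ∀ x, 0 < p x) (hp1 : ∑ x, p x = 1) (hq : ∀ x, 0 < q x)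
    (hq1 : ∑ x, q x = 1) {q₂ : X → X → X → ℝ} (hq₂ : ∀ x s y, 0 ≤ q₂ x s y)
    (hq₂row : ∀ x s, ∑ y, q₂ x s y ≤ 1) (f : X → ℝ) :
    asympVar f p (drKernel (fun _ z => q z) q₂ p) ≤ asympVar f p (mhKernel (fun _ z => q z) p) :=
  asympVar_drKernel_le_mhKernel hp hp1 (fun _ z => (hq z).le) (fun _ => hq1.le) hq₂ hq₂row
    (imh_isIrreducible hp hq hq1) f

/-- **… and the right spectral gap does not decrease**: `Gap_R(A_flow) ≤ Gap_R(k_DR)`. -/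
theorem spectralGapR_imh_le_flowDR (hp : ∀ x, 0 < p x) (hq : ∀ x, 0 < q x)
    (hq1 : ∑ x, q x = 1) {q₂ : X → X → X → ℝ} (hq₂ : ∀ x s y, 0 ≤ q₂ x s y) :
    spectralGapR p (mhKernel (fun _ z => q z) p : Matrix X X ℝ) ≤
      spectralGapR p (drKernel (fun _ z => q z) q₂ p) :=
  spectralGapR_mhKernel_le_drKernel hp (fun _ z => (hq z).le) (fun _ => hq1.le) hq₂

/-! ## Delayed acceptance: screen the flow proposal with a cheap `p*` first -/

/-- The delayed-acceptance flow chain is irreducible: its proposal stage (flow-IMH for the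
approximate target `p*`) has all entries positive, hence so has its Metropolis–Hastings correction
for `p`. -/
theorem flowDA_isIrreducible (hp : ∀ x, 0 < p x) {ps : X → ℝ} (hps : ∀ x, 0 < ps x)
    (hq : ∀ x, 0 < q x) (hq1 : ∑ x, q x = 1) :
    IsIrreducible (surrogateKernel (mhKernel (fun _ z => q z) ps) p ps) := by
  have hS0 : ∀ x y, 0 ≤ mhKernel (fun _ z => q z) ps x y :=
    mhKernel_nonneg (fun _ z => (hq z).le) (fun _ => hq1.le) hps
  rw [surrogateKernel_eq_mhKernel hps hS0 (mhKernel_detailedBalance hps _)]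
  intro x y
  refine ⟨1, ?_⟩
  rw [pow_one]
  by_cases hxy : y = x
  · subst hxy
    -- diagonal: at least the self-proposal mass of the surrogate step, which is positive
    rw [mhKernel_self]
    have h := mhKernel_sum_eq_one (mhKernel (fun _ z => q z) ps) p y
    rw [← add_sum_erase _ _ (mem_univ y), mhKernel_self] at h
    have hrate : ∀ z, mhRate (mhKernel (fun _ z => q z) ps) p y z ≤
        mhKernel (fun _ z => q z) ps y z := fun z => mhRate_le _ _ _ _
    have hsum : ∑ z ∈ univ.erase y, mhRate (mhKernel (fun _ z => q z) ps) p y z ≤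
        ∑ z ∈ univ.erase y, mhKernel (fun _ z => q z) ps y z := sum_le_sum fun z _ => hrate z
    have hrow : ∑ z ∈ univ.erase y, mhKernel (fun _ z => q z) ps y z =
        1 - mhKernel (fun _ z => q z) ps y y := by
      have h1 := mhKernel_sum_eq_one (fun _ z => q z) ps y
      rw [← add_sum_erase _ _ (mem_univ y)] at h1
      linarith
    have hdiag : 0 < mhKernel (fun _ z => q z) ps y y := imh_pos hps hq hq1 y y
    linarith
  · rw [mhKernel_of_ne hxy]
    unfold mhRate
    exact lt_min (imh_pos hps hq hq1 x y)
      (div_pos (mul_pos (hp y) (imh_pos hps hq hq1 y x)) (hp x))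

/-- **DELAYED ACCEPTANCE IS EXACT BUT NEVER BETTER PER STEP**: screening the flow proposal with an
approximate target `p* > 0` and then correcting with `p/p*` leaves `p` invariant and gives
`v(f, A_flow) ≤ v(f, k_DA)` for every observable `f` (what it can buy is a cheaper step). -/
theorem asympVar_imh_le_flowDA (hp : ∀ x, 0 < p x) (hp1 : ∑ x, p x = 1) {ps : X → ℝ}
    (hps : ∀ x, 0 < ps x) (hq : ∀ x, 0 < q x) (hq1 : ∑ x, q x = 1) (f : X → ℝ) :
    asympVar f p (mhKernel (fun _ z => q z) p) ≤
      asympVar f p (surrogateKernel (mhKernel (fun _ z => q z) ps) p ps) :=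
  asympVar_mhKernel_le_surrogateKernel hp hp1 hps (fun _ z => (hq z).le) (fun _ => hq1.le)
    (flowDA_isIrreducible hp hps hq hq1) f

/-- **… and `Gap_R(k_DA) ≤ Gap_R(A_flow)`**. -/
theorem spectralGapR_flowDA_le_imh (hp : ∀ x, 0 < p x) {ps : X → ℝ} (hps : ∀ x, 0 < ps x)
    (hq : ∀ x, 0 < q x) (hq1 : ∑ x, q x = 1) :
    spectralGapR p (surrogateKernel (mhKernel (fun _ z => q z) ps) p ps) ≤
      spectralGapR p (mhKernel (fun _ z => q z) p : Matrix X X ℝ) :=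
  spectralGapR_surrogateKernel_le hp hps (fun _ z => (hq z).le) (fun _ => hq1.le)

end Summit.Ventures.LatticeQCDFlow.Scoring
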